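import Summits.AtomisticToContinuum.HydrodynamicLimit.Theorems.AntiMazurCoboundariesCorrectorPressureDecayKiferCanonicalLocalLimit
import Literature.MathematicalPhysics.KineticTheory.HardSphereGibbsGNZSandwich
import Mathlib.InformationTheory.KullbackLeibler.Basic

/-! Scratch: signatures of the c9 wave-3 stubs — the thermodynamic piece (B) of the Gibbs route decomposed
((B1) mean count of free boxes vs. the density of the Gibbs state, (B2) variance bound, (B3) insertion-ratio bounds,
the abstract Chebyshev–pigeonhole–push lemma, and the free-measure sub-window bound used by the glue). -/

noncomputable section

open MeasureTheory ProbabilityTheory Set Filter Topology InformationTheory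
open scoped ENNReal NNReal

namespace Summit.AtomisticToContinuum.HydrodynamicLimit.Theorems.KiferCompactification

open Literature.MathematicalPhysics.KineticTheory (T3 V3 hsDiameter localGibbsLaw blowUpPoint blowUp)
open Literature.MathematicalPhysics.KineticTheory.HardSphereDLR (gibbsSpecMeasure)
open Literature.MathematicalPhysics.KineticTheory.PointProcess (windowLaw windowRestrict centredBox density)
open Literature.Analysis.FluidPDE (HardSphereFlow Config IsHardCore IsHardSphereGibbs IsTranslationInvariant)
open Literature.Analysis.FunctionSpaces (PointConfig)

/-- W3-1: free-measure sub-window bound (consistency of the free specification + void bound). -/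
theorem c9_windowLaw_free_ge_free {z β : ℝ} {u : V3} (hz : 0 ≤ z) (hβ : 0 < β) {Λ W : Set V3} (hΛ : MeasurableSet Λ)
    (hΛb : Bornology.IsBounded Λ) (hW : MeasurableSet W) (hWΛ : W ⊆ Λ) {A : Set (PointConfig (V3 × V3))}
    (hA : MeasurableSet A) :
    ENNReal.ofReal (Real.exp (-(z * (volume (Metric.thickening 1 W \ W)).toReal))) * gibbsSpecMeasure 1 z β u W ∅ A ≤
      windowLaw W (gibbsSpecMeasure 1 z β u Λ ∅) A := by
  sorry

/-- W3-2 (B3): insertion-ratio bounds for the particle number under the free measure. -/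
theorem c9_free_count_succ_ratio_bounds {z β : ℝ} {u : V3} (hz : 0 < z) (hβ : 0 < β) {Λ : Set V3} (hΛ : MeasurableSet Λ)
    (hΛb : Bornology.IsBounded Λ) (j : ℕ) :
    ENNReal.ofReal (z * ((volume Λ).toReal - 4 * Real.pi / 3 * j) / (j + 1)) *
        gibbsSpecMeasure 1 z β u Λ ∅ {ω | ω.count univ = j} ≤ gibbsSpecMeasure 1 z β u Λ ∅ {ω | ω.count univ = (j + 1 : ℕ)} ∧
      gibbsSpecMeasure 1 z β u Λ ∅ {ω | ω.count univ = (j + 1 : ℕ)} ≤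
        ENNReal.ofReal (z * (volume Λ).toReal / (j + 1)) * gibbsSpecMeasure 1 z β u Λ ∅ {ω | ω.count univ = j} := by
  sorry

/-- W3-3 (B1): the mean particle number of a large free box is the density of the Gibbs state times the volume, up to a surface term. -/
theorem c9_free_mean_count_sub_density_mul_volume_le {z β : ℝ} {u : V3} (hz : 0 < z) (hz1 : z ≤ 1 / 64) (hβ : 0 < β)
    {G : Measure (PointConfig (V3 × V3))} (hG : IsHardSphereGibbs 1 z β u G) (hGT : IsTranslationInvariant G) :
    ∃ C : ℝ, ∀ n : ℕ,
      |(∫⁻ ω, ((ω.count univ : ℕ∞) : ℝ≥0∞) ∂(gibbsSpecMeasure 1 z β u (centredBox n) ∅)).toReal -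
          (density G).toReal * (2 * ((n : ℝ) + 1)) ^ 3| ≤ C * ((n : ℝ) + 1) ^ 2 := by
  sorry

/-- W3-4 (B2): the variance of the particle number of a free box grows at most like the volume. -/
theorem c9_free_count_variance_le {z β : ℝ} {u : V3} (hz : 0 < z) (hz1 : z ≤ 1 / 64) (hβ : 0 < β) :
    ∃ C : ℝ, ∀ n : ℕ,
      ∫ ω, ((((ω.count univ : ℕ∞) : ℝ≥0∞).toReal) -
          ∫ ω', (((ω'.count univ : ℕ∞) : ℝ≥0∞).toReal) ∂(gibbsSpecMeasure 1 z β u (centredBox n) ∅)) ^ 2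
        ∂(gibbsSpecMeasure 1 z β u (centredBox n) ∅) ≤ C * ((n : ℝ) + 1) ^ 3 := by
  sorry

/-- W3-5: the abstract Chebyshev–pigeonhole–push lower bound for a point mass of a law on `ℕ`. -/
theorem c9_pointMass_ge_of_chebyshev_push (K : ℕ) (p : ℕ → ℝ) (hp0 : ∀ j, 0 ≤ p j)
    (hp1 : ∑ j ∈ Finset.range (K + 1), p j = 1) (hpK : ∀ j, K < j → p j = 0) {r : ℝ} (hr0 : 0 < r) (hr1 : r ≤ 1)
    {lo hi : ℕ} (hratio : ∀ j, lo ≤ j → j < hi → r * p j ≤ p (j + 1) ∧ r * p (j + 1) ≤ p j)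
    {V : ℝ} (hV0 : 0 ≤ V)
    (hV : ∑ j ∈ Finset.range (K + 1), ((j : ℝ) - ∑ i ∈ Finset.range (K + 1), (i : ℝ) * p i) ^ 2 * p j ≤ V)
    (hlo : (lo : ℝ) ≤ (∑ i ∈ Finset.range (K + 1), (i : ℝ) * p i) - 2 * Real.sqrt V)
    (hhi : (∑ i ∈ Finset.range (K + 1), (i : ℝ) * p i) + 2 * Real.sqrt V ≤ hi) (k : ℕ) (hk : lo ≤ k) (hk' : k ≤ hi) :
    3 / (4 * (4 * Real.sqrt V + 2)) * r ^ (hi - lo) ≤ p k := by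
  sorry

end Summit.AtomisticToContinuum.HydrodynamicLimit.Theorems.KiferCompactification

end
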